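import Literature.AlgebraicGeometry.Resolution.HironakaDirectrix
import Mathlib.LinearAlgebra.FiniteDimensional.Lemmas
import HarnessLib

/-!
# The directrix generates: `S ⊆ k[T(S)]` (Hironaka; CoP1, proof of Prop. 4.2)

Topic: `Literature/AlgebraicGeometry/Resolution`. The second half of the characterization of
Hironaka's directrix used as its DEFINITION in [CoP1] = Cossart–Piltant, J. Algebra 320 (2008),
proof of Prop. 4.2 (p. 7): "There exists a minimal `k(x)`-vector subspace `T_x ⊆ 𝔪/𝔪²` … such
that `J_x` is generated by elements in `k(x)[T_x]`. This minimal `T_x` is called the directrix".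
With `T(S)` defined intrinsically (`HironakaDirectrix.lean`: the annihilator of the space `𝕎(S)`
of translation-invariance vectors; minimality `directrix_le_of_subset` proved there), we PROVE

* `aeval_add_mul_eq_self_of_translate_eq` — if `F(Y + Tw) = F(Y)` then `F(Y + P·w) = F(Y)` for
  every polynomial `P` (specialise `T ↦ P`);
* `subset_linearFormsSubalgebra_directrix` — **`S ⊆ k[T(S)]`**: for a basis `w_1, …, w_m` of
  `𝕎(S)` and linear forms `λ_j` with `λ_j(w_{j'}) = δ_{jj'}`, iterating the above with
  `P = −λ_j(Y)` gives `F(Y) = F(L(Y))` for the linear forms `L_i = Y_i − Σ_j w_{j,i} λ_j(Y)`,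
  which vanish on `𝕎(S)`, i.e. lie in `T(S)`;
* `directrix_eq_sInf` — **`T(S)` is the least subspace `T'` with `S ⊆ k[T']`** ([CoP1]'s
  definition, recovered), `exists_subset_linearFormsSubalgebra_finrank_eq` (`S ⊆ k[T']` for some
  `T'` of dimension `τ(S)`).

## Sources

* V. Cossart, O. Piltant, J. Algebra 320 (2008), proof of Prop. 4.2, p. 7. [CossartPiltant2008]
* H. Hironaka, Ann. of Math. 92 (1970) ([CoP1] ref. [25]) — background.
-/

noncomputable section

open MvPolynomial

namespace Literature.AlgebraicGeometry.Resolution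

universe u

/-! ## Specialising the translation parameter -/

section Specialize

variable (k : Type u) [CommRing k] {d : ℕ}

/-- The specialisation `T ↦ P`, `Y_i ↦ Y_i` from `k[Y, T]` to `k[Y]`. [folklore] -/
def specializeT (P : MvPolynomial (Fin d) k) :
    MvPolynomial (Option (Fin d)) k →ₐ[k] MvPolynomial (Fin d) k :=
  aeval fun o : Option (Fin d) => o.elim P fun i => X i

/-- `T ↦ P` is a retraction of `k[Y] ⊆ k[Y, T]`. [folklore] -/
theorem specializeT_rename_some (P F : MvPolynomial (Fin d) k) :
    specializeT k P (rename some F) = F := by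
  have : (specializeT k P).comp (rename some) = AlgHom.id k (MvPolynomial (Fin d) k) :=
    MvPolynomial.algHom_ext fun i => by simp [specializeT]
  exact AlgHom.congr_fun this F

/-- Specialising a translation: `(T ↦ P) ∘ τ_w ∘ (k[Y] ⊆ k[Y,T])` is `Y_i ↦ Y_i + w_i P`.
[folklore] -/
theorem specializeT_comp_translate_comp_rename (P : MvPolynomial (Fin d) k) (w : Fin d → k) :
    ((specializeT k P).comp (translate k w)).comp (rename some) =
      aeval fun i => X i + C (w i) * P := by
  refine MvPolynomial.algHom_ext fun i => ?_
  rw [AlgHom.comp_apply, AlgHom.comp_apply, rename_X, translate_X_some, map_add, map_mul,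
    MvPolynomial.algHom_C, MvPolynomial.algebraMap_eq, aeval_X]
  simp [specializeT]

/-- **If `F(Y + Tw) = F(Y)` then `F(Y + P w) = F(Y)` for every polynomial `P`** (substitute
`T ↦ P`). [cite: CossartPiltant2008, proof of Prop. 4.2] -/
theorem aeval_add_mul_eq_self_of_translate_eq {w : Fin d → k} {F : MvPolynomial (Fin d) k}
    (hF : translate k w (rename some F) = rename some F) (P : MvPolynomial (Fin d) k) :
    aeval (fun i => X i + C (w i) * P) F = F := by
  have h := congrArg (specializeT k P) hF
  rw [specializeT_rename_some, ← AlgHom.comp_apply, ← AlgHom.comp_apply,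
    specializeT_comp_translate_comp_rename] at h
  exact h

/-- `linearFormPoly` is additive. [folklore] -/
theorem linearFormPoly_add (ℓ ℓ' : Module.Dual k (Fin d → k)) :
    linearFormPoly k (ℓ + ℓ') = linearFormPoly k ℓ + linearFormPoly k ℓ' := by
  simp only [linearFormPoly, LinearMap.add_apply, C_add, add_mul, Finset.sum_add_distrib]

/-- `linearFormPoly` is homogeneous. [folklore] -/
theorem linearFormPoly_smul (a : k) (ℓ : Module.Dual k (Fin d → k)) :
    linearFormPoly k (a • ℓ) = C a * linearFormPoly k ℓ := by
  simp only [linearFormPoly, LinearMap.smul_apply, smul_eq_mul, C_mul, mul_assoc, Finset.mul_sum]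

/-- `linearFormPoly` as a linear map. [folklore] -/
def linearFormPolyₗ : Module.Dual k (Fin d → k) →ₗ[k] MvPolynomial (Fin d) k where
  toFun := linearFormPoly k
  map_add' := linearFormPoly_add k
  map_smul' a ℓ := by rw [linearFormPoly_smul, RingHom.id_apply, smul_eq_C_mul]

/-- `linearFormPolyₗ` is `linearFormPoly`. [folklore] -/
@[simp] theorem linearFormPolyₗ_apply (ℓ : Module.Dual k (Fin d → k)) :
    linearFormPolyₗ k ℓ = linearFormPoly k ℓ := rfl

/-- The coordinate form `e_i^*` gives `Y_i`. [folklore] -/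
theorem linearFormPoly_proj (i : Fin d) :
    linearFormPoly k (LinearMap.proj i : Module.Dual k (Fin d → k)) = X i := by
  rw [linearFormPoly, Finset.sum_eq_single i]
  · simp
  · intro j _ hji
    simp [Ne.symm hji]
  · exact fun h => (h (Finset.mem_univ i)).elim

/-- Evaluating a linear form at linear substitutions: `ℓ(L_1, …, L_d) = Σ_i ℓ(e_i) L_i`.
[folklore] -/
theorem aeval_linearFormPoly (L : Fin d → MvPolynomial (Fin d) k) (ℓ : Module.Dual k (Fin d → k)) :
    aeval L (linearFormPoly k ℓ) = ∑ i, C (ℓ (Pi.single i 1)) * L i := by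
  simp only [linearFormPoly, map_sum, map_mul, MvPolynomial.algHom_C, MvPolynomial.algebraMap_eq,
    aeval_X]

end Specialize

/-! ## `S ⊆ k[T(S)]` -/

section Span

variable (k : Type u) [Field k] {d : ℕ}

/-- **The iteration**: for vectors `w_j ∈ 𝕎(S)`-style invariance directions of `F` and linear
forms `λ_j` with `λ_j(w_{j'}) = 0` for `j ≠ j'`, `F(Y) = F(L_s(Y))` where
`L_{s,i} = Y_i − Σ_{j ∈ s} w_{j,i} λ_j(Y)` for every finite set `s` of indices.
[cite: CossartPiltant2008, proof of Prop. 4.2] -/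
theorem aeval_sub_sum_eq_self {m : ℕ} (w : Fin m → Fin d → k) (lam : Fin m → Module.Dual k (Fin d → k))
    (hlam : ∀ j j', j ≠ j' → lam j (w j') = 0) {F : MvPolynomial (Fin d) k}
    (hF : ∀ j, translate k (w j) (rename some F) = rename some F) (s : Finset (Fin m)) :
    aeval (fun i => X i - ∑ j ∈ s, C (w j i) * linearFormPoly k (lam j)) F = F := by
  classical
  induction s using Finset.induction_on with
  | empty =>
    have : (fun i : Fin d => X i - ∑ j ∈ (∅ : Finset (Fin m)), C (w j i) * linearFormPoly k (lam j)) =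
        fun i => (X i : MvPolynomial (Fin d) k) := by
      ext i; rw [Finset.sum_empty, sub_zero]
    rw [this, MvPolynomial.aeval_X_left, AlgHom.id_apply]
  | insert j s hjs ih =>
    -- `aeval L_{insert j s} = aeval L_s ∘ (Y ↦ Y − w_j λ_j(Y))`
    have hℓ : aeval (fun i => X i - ∑ j' ∈ s, C (w j' i) * linearFormPoly k (lam j'))
        (linearFormPoly k (lam j)) = linearFormPoly k (lam j) := by
      rw [aeval_linearFormPoly]
      simp only [mul_sub, Finset.sum_sub_distrib, Finset.mul_sum]
      rw [show (∑ x, C (lam j (Pi.single x 1)) * X x : MvPolynomial (Fin d) k) =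
        linearFormPoly k (lam j) from rfl, sub_eq_self, Finset.sum_comm]
      refine Finset.sum_eq_zero fun j' hj' => ?_
      have hjj' : j ≠ j' := fun h => hjs (h ▸ hj')
      have : ∑ i, C (lam j (Pi.single i 1)) * (C (w j' i) * linearFormPoly k (lam j')) =
          C (lam j (w j')) * linearFormPoly k (lam j') := by
        rw [dual_apply_eq_sum, map_sum, Finset.sum_mul]
        exact Finset.sum_congr rfl fun i _ => by rw [map_mul]; ring
      rw [this, hlam j j' hjj', map_zero, zero_mul]
    have hcomp : (aeval fun i => X i - ∑ j' ∈ insert j s, C (w j' i) * linearFormPoly k (lam j')) =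
        (aeval fun i => X i - ∑ j' ∈ s, C (w j' i) * linearFormPoly k (lam j')).comp
          (aeval fun i => X i + C (w j i) * (-linearFormPoly k (lam j))) := by
      refine MvPolynomial.algHom_ext fun i => ?_
      rw [aeval_X, AlgHom.comp_apply, aeval_X, map_add, map_mul, map_neg, MvPolynomial.algHom_C,
        MvPolynomial.algebraMap_eq, aeval_X, hℓ, Finset.sum_insert hjs]
      ring
    rw [hcomp, AlgHom.comp_apply, aeval_add_mul_eq_self_of_translate_eq k (hF j), ih]

/-- **`S ⊆ k[T(S)]`: every `F ∈ S` is a polynomial in linear forms of the directrix** (the half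
of [CoP1]'s characterization "`J_x` is generated by elements in `k(x)[T_x]`" for the intrinsic
`T(S)`; Hironaka). Proof: choose a basis `w_1, …, w_m` of `𝕎(S)` and linear forms `λ_j` on
`k^d` with `λ_j(w_{j'}) = δ_{jj'}`; by `aeval_sub_sum_eq_self`, `F = F(L(Y))` with
`L_i = Y_i − Σ_j w_{j,i} λ_j(Y)`, linear forms vanishing on all `w_j`, hence in `T(S)`.
[cite: CossartPiltant2008, proof of Prop. 4.2] -/
theorem subset_linearFormsSubalgebra_directrix (S : Set (MvPolynomial (Fin d) k)) :
    S ⊆ linearFormsSubalgebra k (directrix k S) := by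
  classical
  intro F hFS
  -- a basis of `𝕎 = 𝕎(S)` and dual linear forms on `k^d`
  set 𝕎 := invarianceSpace k S with h𝕎
  let b := Module.finBasis k 𝕎
  set m := Module.finrank k 𝕎 with hm
  let w : Fin m → Fin d → k := fun j => (b j : Fin d → k)
  have hlamex : ∀ j : Fin m, ∃ g : Module.Dual k (Fin d → k), g.comp 𝕎.subtype = b.coord j :=
    fun j => LinearMap.exists_extend (b.coord j)
  choose lam hlam using hlamex
  have hδ : ∀ j j', lam j (w j') = if j' = j then 1 else 0 := by
    intro j j'
    have := LinearMap.congr_fun (hlam j) (b j')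
    rw [LinearMap.comp_apply, Submodule.subtype_apply, Module.Basis.coord_apply,
      Module.Basis.repr_self, Finsupp.single_apply] at this
    exact this
  have hlam0 : ∀ j j', j ≠ j' → lam j (w j') = 0 := fun j j' h => by
    rw [hδ, if_neg (Ne.symm h)]
  -- invariance of `F` under each `w_j`
  have hF : ∀ j, translate k (w j) (rename some F) = rename some F :=
    fun j => (b j).2 F hFS
  -- `F = F(L(Y))`
  have key := aeval_sub_sum_eq_self k w lam hlam0 hF Finset.univ
  -- each `L_i` is the linear form of `μ_i = e_i^* − Σ_j w_{j,i} λ_j ∈ T(S)`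
  have hL : ∀ i, (X i - ∑ j ∈ Finset.univ, C (w j i) * linearFormPoly k (lam j) :
      MvPolynomial (Fin d) k) = linearFormPoly k
        ((LinearMap.proj i : Module.Dual k (Fin d → k)) - ∑ j, w j i • lam j) := by
    intro i
    rw [← linearFormPolyₗ_apply, map_sub, map_sum, linearFormPolyₗ_apply, linearFormPoly_proj]
    congr 1
    exact Finset.sum_congr rfl fun j _ => by
      rw [map_smul, linearFormPolyₗ_apply, smul_eq_C_mul]
  have hmem : ∀ i, ((LinearMap.proj i : Module.Dual k (Fin d → k)) - ∑ j, w j i • lam j) ∈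
      directrix k S := by
    intro i
    rw [mem_directrix_iff]
    intro v hv
    -- reduce to the basis vectors of `𝕎`
    have hzero : ((LinearMap.proj i : Module.Dual k (Fin d → k)) - ∑ j, w j i • lam j).comp
        𝕎.subtype = 0 := by
      refine b.ext fun j' => ?_
      rw [LinearMap.comp_apply, Submodule.subtype_apply, LinearMap.zero_apply, LinearMap.sub_apply,
        LinearMap.proj_apply, LinearMap.sum_apply]
      simp only [LinearMap.smul_apply, smul_eq_mul]
      rw [Finset.sum_eq_single j']
      · rw [hδ, if_pos rfl, mul_one, sub_self]
      · intro j _ hj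
        rw [hlam0 j j' hj, mul_zero]
      · exact fun h => (h (Finset.mem_univ j')).elim
    have := LinearMap.congr_fun hzero ⟨v, hv⟩
    rwa [LinearMap.comp_apply, Submodule.subtype_apply, LinearMap.zero_apply] at this
  have hsub : (Set.range fun i => (X i - ∑ j ∈ Finset.univ, C (w j i) * linearFormPoly k (lam j) :
      MvPolynomial (Fin d) k)) ⊆ linearFormPoly k '' (directrix k S : Set (Module.Dual k (Fin d → k))) := by
    rintro _ ⟨i, rfl⟩
    exact ⟨_, hmem i, (hL i).symm⟩
  have hFmem : aeval (fun i => X i - ∑ j ∈ Finset.univ, C (w j i) * linearFormPoly k (lam j)) F ∈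
      Algebra.adjoin k (Set.range fun i => (X i - ∑ j ∈ Finset.univ,
        C (w j i) * linearFormPoly k (lam j) : MvPolynomial (Fin d) k)) := by
    rw [Algebra.adjoin_range_eq_range_aeval]
    exact ⟨F, rfl⟩
  rw [← key]
  exact Algebra.adjoin_mono hsub hFmem

/-- **[CoP1]'s definition recovered: `T(S)` is the least subspace `T'` of linear forms with
`S ⊆ k[T']`.** [cite: CossartPiltant2008, proof of Prop. 4.2] -/
theorem directrix_eq_sInf (S : Set (MvPolynomial (Fin d) k)) :
    directrix k S = sInf {T' : Submodule k (Module.Dual k (Fin d → k)) |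
      S ⊆ linearFormsSubalgebra k T'} :=
  le_antisymm (le_sInf fun _ hT' => directrix_le_of_subset k hT')
    (sInf_le (subset_linearFormsSubalgebra_directrix k S))

/-- **`S ⊆ k[T']` for some space of linear forms `T'` of dimension exactly `τ(S)`** (namely
`T' = T(S)`; with `hironakaTau_le_finrank_of_subset`, `τ(S)` is the least such dimension).
[cite: CossartPiltant2008, proof of Prop. 4.2] -/
theorem exists_subset_linearFormsSubalgebra_finrank_eq (S : Set (MvPolynomial (Fin d) k)) :
    ∃ T' : Submodule k (Module.Dual k (Fin d → k)),
      S ⊆ linearFormsSubalgebra k T' ∧ Module.finrank k T' = hironakaTau k S :=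
  ⟨directrix k S, subset_linearFormsSubalgebra_directrix k S, rfl⟩

end Span

end Literature.AlgebraicGeometry.Resolution

end
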